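import Summits.Ventures.Crystal3D.Theorems.StickyWulffConstantPolycrystalWulffBoundRungInclinedShift
import Summits.Ventures.Crystal3D.Theorems.StickyWulffConstantPolycrystalWulffBoundMinkowskiUpper
import Summits.Ventures.Crystal3D.Theorems.StickyWulffConstantPolycrystalWulffBoundPolyClosure
import Summits.Ventures.Crystal3D.Theorems.StickyWulffConstantPolycrystalWulffBoundSeparated

/-!
# `PolycrystalWulffBound`, line `PolyDensity`: LOCAL forms of the charged-wall rungs (crux `stmt-Ventures-19482`)

Route `StickyWulffConstant`, second prover lane (poly-p2, gen 8).  `rung_inclinedLamellar_of_quantiles_local` /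
`rung_inclinedLamellar_of_cdfShift_local`: exactly `…RungInclined` / `…RungInclinedShift` (inclined lamellae, quantile
mismatch `δ`, conclusion `6·2^{1/3}(√2·Vol)^{2/3} ≤ Fr + δ·Σ_f S_f`) but with the one-sided section bounds
`|E ∩ {a_{f+1} − h ≤ ⟪·,n⟫ < a_{f+1}}| ≤ h·S_f` required only for `h < h₀` — so `S_f` may be taken as the wall's
section area `+ ε` (by continuity) instead of a bound on all average sections below the wall.  Same proof with a
smaller radius (`r·δ < h₀`); `maxHeartbeats 400000` for the long elaboration.
WHAT THIS IS NOT: `S_f = |wall_f|` itself; the crux is not claimed. -/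

noncomputable section

open scoped BigOperators InnerProductSpace ENNReal Pointwise Topology
open MeasureTheory Filter Set

namespace Summit.Ventures.Crystal3D.Cruxes.PolycrystalWulffBound.PolyDensity

open Summit.Ventures.Crystal3D.Theorems
open Summit.Ventures.Crystal3D.Cruxes.TextureLiminf.TexShadow (per polytope E3)
open Literature.MathematicalPhysics.StatisticalMechanics (fccStacking barlowStacking IsHaggSeq perimeter)

set_option maxHeartbeats 400000 in
/-- **Rung `rung_inclinedLamellar_of_quantiles_local`**: as `rung_inclinedLamellar_of_quantiles` with the
section bounds required only for `h < h₀`. -/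
theorem rung_inclinedLamellar_of_quantiles_local : let Λ : Set (EuclideanSpace ℝ (Fin 3)) := Literature.MathematicalPhysics.StatisticalMechanics.fccStacking 1 (Real.sqrt (2 / 3)); let Φ : EuclideanSpace ℝ (Fin 3) → ℝ := fun ν => Real.sqrt 2 / 4 * ∑ᶠ w ∈ {w ∈ Λ | ‖w‖ = 1}, |⟪w, ν⟫_ℝ|; let Per : Set (EuclideanSpace ℝ (Fin 3)) → Set (EuclideanSpace ℝ (Fin 3)) → ℝ := fun K S => (⨆ (ξ : EuclideanSpace ℝ (Fin 3) → EuclideanSpace ℝ (Fin 3)) (_ : ContDiff ℝ 1 ξ ∧ HasCompactSupport ξ ∧ ∀ z, ξ z ∈ K), ENNReal.ofReal (∫ z in S, Literature.MathematicalPhysics.StatisticalMechanics.fieldDivergence ξ z)).toReal; let ι : Set (EuclideanSpace ℝ (Fin 3)) → Set (EuclideanSpace ℝ (Fin 3)) → Set (EuclideanSpace ℝ (Fin 3)) → ℝ := fun K S₁ S₂ => (Per K S₁ + Per K S₂ - Per K (S₁ ∪ S₂)) / 2; let W : (EuclideanSpace ℝ (Fin 3) ≃ₗᵢ[ℝ]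 EuclideanSpace ℝ (Fin 3)) → Set (EuclideanSpace ℝ (Fin 3)) := fun A => {y | ∀ ν : EuclideanSpace ℝ (Fin 3), ⟪y, ν⟫_ℝ ≤ Φ (A.symm ν)}; let Vol : (n : ℕ) → (Fin n → Set (EuclideanSpace ℝ (Fin 3))) → ℝ := fun n G => (volume (⋃ f : Fin n, G f)).toReal; let Poly : Set (EuclideanSpace ℝ (Fin 3)) → Prop := fun S => ∃ (k : ℕ) (H : Fin k → Finset ((EuclideanSpace ℝ (Fin 3)) × ℝ)), S = ⋃ i, ⋂ p ∈ H i, {x | ⟪p.1, x⟫_ℝ < p.2}; let Fr : (n : ℕ) → (Fin n → Set (EuclideanSpace ℝ (Fin 3))) → (Fin n → (EuclideanSpace ℝ (Fin 3) ≃ₗᵢ[ℝ] EuclideanSpace ℝ (Fin 3))) → ℝ := fun n G A => ∑ f : Fin n, Per (W (A f)) (G f) - ∑ f, ∑ g, (if f = g then 0 else ι (W (A f)) (G f) (G g)); ∀ (E : Set (EuclideanSpace ℝ (Fin 3))), Poly E → volume E < ⊤ → ∀ (n : EuclideanSpace ℝ (Fin 3)), ‖n‖ = 1 → ∀ (k :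 ℕ) (a : Fin (k + 1) → ℝ), StrictMono a → ∀ (A : Fin k → (EuclideanSpace ℝ (Fin 3) ≃ₗᵢ[ℝ] EuclideanSpace ℝ (Fin 3))) (q : Fin k → ℝ → ℝ) (Q δ : ℝ) (S : Fin k → ℝ), (∀ f σ₁ σ₂, 0 ≤ σ₁ → σ₁ ≤ σ₂ → σ₂ ≤ 1 → ENNReal.ofReal ((σ₂ - σ₁) * 32) ≤ volume (W (A f) ∩ {y | q f σ₁ < ⟪y, n⟫_ℝ ∧ ⟪y, n⟫_ℝ < q f σ₂})) → (∀ f σ, 0 ≤ σ → σ ≤ 1 → |q f σ| ≤ Q) → 0 ≤ δ → (∀ (f g : Fin k) (σ : ℝ), (f : ℕ) + 1 = g → 0 ≤ σ → σ ≤ 1 → q f σ ≤ q g σ + δ) → (∀ f, 0 ≤ S f) → ∀ (h₀ : ℝ), 0 < h₀ → (∀ f (h : ℝ), 0 < h → h < h₀ → volume (E ∩ {x | a f.succ - h ≤ ⟪x, n⟫_ℝ ∧ ⟪x, n⟫_ℝ < a f.succ}) ≤ ENNReal.ofReal (h * S f)) → 6 * (2 : ℝ) ^ ((1 : ℝ)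 / 3) * (Real.sqrt 2 * Vol k (fun f => E ∩ {x | a f.castSucc < ⟪x, n⟫_ℝ ∧ ⟪x, n⟫_ℝ < a f.succ})) ^ ((2 : ℝ) / 3) ≤ Fr k (fun f => E ∩ {x | a f.castSucc < ⟪x, n⟫_ℝ ∧ ⟪x, n⟫_ℝ < a f.succ}) A + δ * ∑ f, S f := by
  intro Λ Φ Per ι W Vol Poly Fr E hE hEv n hn k a ha A q Q δ S hq hQ hδ hqq hS0 h₀ hh₀ hS
  classical
  -- the lamellae
  set slab : Fin k → Set E3 := fun f => {x : E3 | a f.castSucc < ⟪x, n⟫_ℝ ∧ ⟪x, n⟫_ℝ < a f.succ}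
    with hslab
  set G : Fin k → Set E3 := fun f => E ∩ slab f with hG
  show 6 * (2 : ℝ) ^ ((1 : ℝ) / 3) * (Real.sqrt 2 * (volume (⋃ f, G f)).toReal) ^ ((2 : ℝ) / 3) ≤
    (∑ f, Per (W (A f)) (G f)) - ∑ f, ∑ g, (if f = g then 0 else ι (W (A f)) (G f) (G g)) + δ * ∑ f, S f
  rw [← Finset.sum_sub_distrib]
  have hPolyG : ∀ f, ∃ (k : ℕ) (H : Fin k → Finset (E3 × ℝ)), G f = ⋃ i, polytope (H i) :=
    fun f => poly_inter_slab hE n (a f.castSucc) (a f.succ)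
  have hvolG : ∀ f, volume (G f) < ⊤ := fun f => lt_of_le_of_lt (measure_mono inter_subset_left) hEv
  have hdisjG : ∀ f g, f ≠ g → Disjoint (G f) (G g) := by
    intro f g hfg
    rw [Set.disjoint_left]
    rintro x ⟨-, hxf⟩ ⟨-, hxg⟩
    exact hfg (lamella_index_unique ha hxf hxg)
  -- bodies
  have hWc : ∀ f, IsCompact (W (A f)) := fun f => isCompact_cruxWulffBody (A f)
  have hWv : ∀ f, Convex ℝ (W (A f)) := fun f => convex_cruxWulffBody (A f)
  have hW0 : ∀ f, (0 : E3) ∈ W (A f) := fun f => zero_mem_cruxWulffBody (A f)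
  have hWs : ∀ f, -W (A f) = W (A f) := fun f => neg_cruxWulffBody_eq (A f)
  -- the free energy is nonnegative
  have hFr0 : 0 ≤ ∑ f, (Per (W (A f)) (G f) - ∑ g, (if f = g then 0 else ι (W (A f)) (G f) (G g))) := by
    have h := freeEnergy_ge_mul_perimeter G hPolyG hvolG hdisjG (fun f => W (A f)) hWc hWv hW0 hWs
      (Real.sqrt_pos.2 (by norm_num : (0:ℝ) < 3)) (fun f => closedBall_subset_cruxWulffBody (A f))
    exact le_trans (mul_nonneg (Real.sqrt_nonneg 3) ENNReal.toReal_nonneg) h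
  set V : ℝ := (volume (⋃ f, G f)).toReal with hV
  have hV0 : 0 ≤ V := ENNReal.toReal_nonneg
  set F : ℝ := ∑ f, (Per (W (A f)) (G f) - ∑ g, (if f = g then 0 else ι (W (A f)) (G f) (G g))) with hF
  set D : ℝ := δ * ∑ f, S f with hD
  have hD0 : 0 ≤ D := mul_nonneg hδ (Finset.sum_nonneg fun f _ => hS0 f)
  -- measurability / finiteness
  have hslabm : ∀ f, MeasurableSet (slab f) := fun f =>
    (continuous_id.inner continuous_const).measurable (measurableSet_Ioo (a := a f.castSucc) (b := a f.succ))
  have hEopen : IsOpen E := by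
    obtain ⟨k, H, rfl⟩ := hE
    exact isOpen_iUnion fun i => isOpen_biInter_finset fun q _ =>
      isOpen_lt (continuous_const.inner continuous_id) continuous_const
  have hEm : MeasurableSet E := hEopen.measurableSet
  have hGm : ∀ f, MeasurableSet (G f) := fun f => hEm.inter (hslabm f)
  have hE'top : volume (⋃ f, G f) ≠ ⊤ :=
    (lt_of_le_of_lt (measure_mono (iUnion_subset fun f => inter_subset_left)) hEv).ne
  by_cases hE'0 : volume (⋃ f, G f) = 0
  · have hV00 : V = 0 := by rw [hV, hE'0, ENNReal.toReal_zero]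
    rw [hV00, mul_zero, Real.zero_rpow (by norm_num), mul_zero]
    linarith
  have hVpos : 0 < V := ENNReal.toReal_pos hE'0 hE'top
  -- there is a lamella, hence `k ≠ 0`; the minimal thickness of a lamella
  obtain ⟨x₀, hx₀⟩ := nonempty_of_measure_ne_zero hE'0
  obtain ⟨f₀, -⟩ := mem_iUnion.1 hx₀
  obtain ⟨f₁, -, hf₁⟩ := Finset.exists_min_image Finset.univ
    (fun f : Fin k => a f.succ - a f.castSucc) ⟨f₀, Finset.mem_univ _⟩
  set m₀ : ℝ := a f₁.succ - a f₁.castSucc with hm₀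
  have hm₀0 : 0 < m₀ := sub_pos.2 (ha f₁.castSucc_lt_succ)
  have hm₀le : ∀ f : Fin k, m₀ ≤ a f.succ - a f.castSucc := fun f => hf₁ f (Finset.mem_univ _)
  have hamono : Monotone a := ha.monotone
  have hQ0 : 0 ≤ Q := le_trans (abs_nonneg _) (hQ f₀ 0 le_rfl zero_le_one)
  -- `E` is bounded
  have hEbd : Bornology.IsBounded E := by
    obtain ⟨k, H, hEeq⟩ := hE
    rw [hEeq]
    refine Bornology.isBounded_iUnion.2 fun i => isBounded_hPolyhedron_of_volume_lt_top (H i) ?_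
    exact lt_of_le_of_lt (measure_mono (by
      rw [hEeq]; exact subset_iUnion (fun i => ⋂ p ∈ H i, {x : E3 | ⟪p.1, x⟫_ℝ < p.2}) i)) hEv
  -- the main estimate: for small `ε`, `3·32^{1/3}·((V − ε)^{1/3})² ≤ F + D + ε`
  have key : ∀ ε : ℝ, 0 < ε → ε < V →
      3 * (32 : ℝ) ^ ((3 : ℝ)⁻¹) * ((V - ε) ^ ((3 : ℝ)⁻¹)) ^ 2 ≤ F + D + ε := by
    intro ε hε hεV
    obtain ⟨r₀, hr₀, hup⟩ := volume_chimera_texture_le G hPolyG hvolG hdisjG (fun f => W (A f))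
      hWc hWv hW0 hWs hε
    -- the radius: below `r₀`, below `ε/(D+1)`, and below `m₀/(2Q+δ+1)`
    set r : ℝ := min (min (r₀ / 2) (h₀ / (2 * (δ + 1))))
      (min (ε / (D + 1)) (m₀ / (2 * Q + δ + 1))) with hr
    have hδ1 : 0 < 2 * (δ + 1) := by linarith only [hδ]
    have hD1 : 0 < D + 1 := by linarith only [hD0]
    have hQ1 : 0 < 2 * Q + δ + 1 := by linarith only [hQ0, hδ]
    have hr0 : 0 < r := by
      rw [hr]
      exact lt_min (lt_min (half_pos hr₀) (div_pos hh₀ hδ1)) (lt_min (div_pos hε hD1) (div_pos hm₀0 hQ1))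
    have hrr₀ : r < r₀ :=
      lt_of_le_of_lt ((min_le_left _ _).trans (min_le_left _ _)) (half_lt_self hr₀)
    have hrh₀ : r * δ < h₀ := by
      have h1 : r ≤ h₀ / (2 * (δ + 1)) := (min_le_left _ _).trans (min_le_right _ _)
      rw [le_div_iff₀ hδ1] at h1
      have h2 : r * δ ≤ r * (δ + 1) :=
        mul_le_mul_of_nonneg_left (by linarith only [hδ]) hr0.le
      linarith only [h1, h2, hh₀]
    have hrε : r * (D + 1) ≤ ε := by
      have : r ≤ ε / (D + 1) := (min_le_right _ _).trans (min_le_left _ _)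
      rwa [le_div_iff₀ hD1] at this
    have hrD : r * D ≤ ε := by
      have : r * D ≤ r * (D + 1) := mul_le_mul_of_nonneg_left (by linarith only [hD0]) hr0.le
      linarith only [this, hrε]
    have hrm : r * (2 * Q + δ + 1) ≤ m₀ := by
      have : r ≤ m₀ / (2 * Q + δ + 1) := (min_le_right _ _).trans (min_le_right _ _)
      rwa [le_div_iff₀ hQ1] at this
    -- the chimera neighbourhood of radius `r` (of the FULL lamellae)
    set C : Set E3 := ⋃ f, ⋃ x ∈ G f, x +ᵥ (r • W (A f)) with hC
    have hCopen : IsOpen C := by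
      have hGo : ∀ f, IsOpen (G f) := fun f => hEopen.inter
        ((continuous_id.inner continuous_const).isOpen_preimage _ isOpen_Ioo)
      have hCeq : C = ⋃ f, ⋃ w ∈ r • W (A f), (fun x => x + w) '' G f := by
        ext y
        simp only [hC, mem_iUnion, Set.mem_vadd_set, vadd_eq_add, mem_image, exists_prop]
        constructor
        · rintro ⟨f, x, hx, w, hw, rfl⟩; exact ⟨f, w, hw, x, hx, rfl⟩
        · rintro ⟨f, w, hw, x, hx, rfl⟩; exact ⟨f, x, hx, w, hw, rfl⟩
      rw [hCeq]
      exact isOpen_iUnion fun f => isOpen_biUnion fun w _ => (isOpenMap_add_right w) _ (hGo f)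
    have hCm : MeasurableSet C := hCopen.measurableSet
    have hCfin : volume C ≠ ⊤ := by
      obtain ⟨R₁, hR₁⟩ := hEbd.subset_closedBall 0
      have hCsub : C ⊆ Metric.closedBall (0 : E3) (R₁ + r * Real.sqrt 5) := by
        intro y hy
        simp only [hC, mem_iUnion, Set.mem_vadd_set, vadd_eq_add, exists_prop] at hy
        obtain ⟨f, x, hx, w, hw, rfl⟩ := hy
        obtain ⟨w', hw', rfl⟩ := Set.mem_smul_set.1 hw
        have hx' : ‖x‖ ≤ R₁ := mem_closedBall_zero_iff.1 (hR₁ hx.1)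
        have hw'' : ‖w'‖ ≤ Real.sqrt 5 := mem_closedBall_zero_iff.1 (cruxWulffBody_subset_closedBall (A f) hw')
        rw [mem_closedBall_zero_iff]
        calc ‖x + r • w'‖ ≤ ‖x‖ + ‖r • w'‖ := norm_add_le _ _
          _ = ‖x‖ + r * ‖w'‖ := by rw [norm_smul, Real.norm_of_nonneg hr0.le]
          _ ≤ R₁ + r * Real.sqrt 5 := by gcongr
      exact (lt_of_le_of_lt (measure_mono hCsub) measure_closedBall_lt_top).ne
    -- the TRIMMED lamellae
    set β : Fin k → ℝ := fun f => a f.succ - r * δ with hβ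
    set G' : Fin k → Set E3 := fun f => E ∩ {x : E3 | a f.castSucc < ⟪x, n⟫_ℝ ∧ ⟪x, n⟫_ℝ < β f} with hG'
    have hG'sub : ∀ f, G' f ⊆ G f := fun f x hx =>
      ⟨hx.1, hx.2.1, lt_of_lt_of_le hx.2.2 (by rw [hβ]; nlinarith)⟩
    have hG'm : ∀ f, MeasurableSet (G' f) := fun f => hEm.inter
      ((continuous_id.inner continuous_const).measurable (measurableSet_Ioo (a := a f.castSucc) (b := β f)))
    have hdisjG' : ∀ f g, f ≠ g → Disjoint (G' f) (G' g) := fun f g hfg =>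
      (hdisjG f g hfg).mono (hG'sub f) (hG'sub g)
    -- the strips removed
    set strip : Fin k → Set E3 := fun f => E ∩ {x : E3 | a f.succ - r * δ ≤ ⟪x, n⟫_ℝ ∧ ⟪x, n⟫_ℝ < a f.succ}
      with hstrip
    have hGsplit : ∀ f, G f ⊆ G' f ∪ strip f := by
      rintro f x ⟨hxE, hx1, hx2⟩
      by_cases hlt : ⟪x, n⟫_ℝ < a f.succ - r * δ
      · exact Or.inl ⟨hxE, hx1, hlt⟩
      · exact Or.inr ⟨hxE, not_lt.1 hlt, hx2⟩
    set V' : ℝ := (volume (⋃ f, G' f)).toReal with hV'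
    have hU'le : volume (⋃ f, G' f) ≤ volume (⋃ f, G f) :=
      measure_mono (iUnion_mono hG'sub)
    have hU'fin : volume (⋃ f, G' f) ≠ ⊤ := ne_top_of_le_ne_top hE'top hU'le
    have hV'le : V' ≤ V := ENNReal.toReal_mono hE'top hU'le
    -- volume lost in the strips
    have hstripvol : ∀ f, volume (strip f) ≤ ENNReal.ofReal (r * δ * S f) := by
      intro f
      rcases eq_or_lt_of_le hδ with hδ0 | hδpos
      · have : strip f = ∅ := by
          ext x
          simp only [hstrip, ← hδ0, mul_zero, sub_zero, mem_inter_iff, mem_setOf_eq, mem_empty_iff_false,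
            iff_false, not_and, not_lt]
          intro _ h; exact h
        rw [this, measure_empty]; exact bot_le
      · exact hS f (r * δ) (mul_pos hr0 hδpos) hrh₀
    have hVV' : V ≤ V' + r * D := by
      have h1 : volume (⋃ f, G f) ≤ volume (⋃ f, G' f) + ∑ f, volume (strip f) := by
        calc volume (⋃ f, G f) ≤ volume ((⋃ f, G' f) ∪ ⋃ f, strip f) := by
              refine measure_mono ?_
              intro x hx
              obtain ⟨f, hxf⟩ := mem_iUnion.1 hx
              rcases hGsplit f hxf with h | h
              · exact Or.inl (mem_iUnion.2 ⟨f, h⟩)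
              · exact Or.inr (mem_iUnion.2 ⟨f, h⟩)
          _ ≤ volume (⋃ f, G' f) + volume (⋃ f, strip f) := measure_union_le _ _
          _ ≤ volume (⋃ f, G' f) + ∑ f, volume (strip f) := by
              gcongr
              exact (measure_iUnion_le _).trans (by rw [tsum_fintype])
      have h2 : ∑ f, volume (strip f) ≤ ENNReal.ofReal (r * D) := by
        calc ∑ f, volume (strip f) ≤ ∑ f, ENNReal.ofReal (r * δ * S f) := Finset.sum_le_sum fun f _ => hstripvol f
          _ = ENNReal.ofReal (∑ f, r * δ * S f) :=
              (ENNReal.ofReal_sum_of_nonneg fun f _ => by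
                have := hS0 f; positivity).symm
          _ = ENNReal.ofReal (r * D) := by rw [hD, Finset.mul_sum, Finset.mul_sum]; congr 1;
                                              exact Finset.sum_congr rfl fun f _ => by ring
      have h3 : volume (⋃ f, G f) ≤ volume (⋃ f, G' f) + ENNReal.ofReal (r * D) := h1.trans (by gcongr)
      have h4 := ENNReal.toReal_mono (ENNReal.add_ne_top.2 ⟨hU'fin, ENNReal.ofReal_ne_top⟩) h3
      rw [ENNReal.toReal_add hU'fin ENNReal.ofReal_ne_top, ENNReal.toReal_ofReal (by positivity)] at h4
      exact h4
    have hV'pos : 0 < V' := by linarith only [hVV', hrD, hεV]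
    have hU'0 : volume (⋃ f, G' f) ≠ 0 := by
      intro h0; rw [hV', h0, ENNReal.toReal_zero] at hV'pos; exact lt_irrefl _ hV'pos
    -- mass fractions and cumulative levels
    have hU'sum : volume (⋃ f, G' f) = ∑ f, volume (G' f) := by
      rw [measure_iUnion (fun f g hfg => hdisjG' f g hfg) hG'm, tsum_fintype]
    set θ : Fin k → ℝ := fun f => (volume (G' f)).toReal / V' with hθ
    have hθ0 : ∀ f, 0 ≤ θ f := fun f => div_nonneg ENNReal.toReal_nonneg hV'pos.le
    have hG'fin : ∀ f, volume (G' f) ≠ ⊤ := fun f =>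
      ne_top_of_le_ne_top hU'fin (measure_mono (subset_iUnion _ f))
    have hθ1 : ∑ f, θ f = 1 := by
      rw [hθ]
      simp only []
      rw [← Finset.sum_div, ← ENNReal.toReal_sum (fun f _ => hG'fin f), ← hU'sum, ← hV',
        div_self hV'pos.ne']
    set θN : ℕ → ℝ := fun i => if h : i < k then θ ⟨i, h⟩ else 0 with hθN
    set σN : ℕ → ℝ := fun i => ∑ j ∈ Finset.range i, θN j with hσN
    have hθN0 : ∀ i, 0 ≤ θN i := fun i => by
      rw [hθN]; simp only []; split_ifs with h
      · exact hθ0 _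
      · exact le_rfl
    have hσN0 : ∀ i, 0 ≤ σN i := fun i => Finset.sum_nonneg fun j _ => hθN0 j
    have hσNk : σN k = 1 := by
      rw [hσN]; simp only []
      rw [Finset.sum_range, ← hθ1]
      refine Finset.sum_congr rfl fun f _ => ?_
      rw [hθN]; simp only [Fin.is_lt, dif_pos, Fin.eta]
    have hσNmono : Monotone σN := by
      intro i j hij
      rw [hσN]; simp only []
      exact Finset.sum_le_sum_of_subset_of_nonneg (Finset.range_mono hij) fun x _ _ => hθN0 x
    have hσN1 : ∀ i, i ≤ k → σN i ≤ 1 := fun i hi => hσNk ▸ hσNmono hi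
    have hσNsucc : ∀ f : Fin k, σN (f + 1) = σN f + θ f := by
      intro f
      rw [hσN]; simp only []
      rw [Finset.sum_range_succ, hθN]; simp only [Fin.is_lt, dif_pos, Fin.eta]
    set lo : Fin k → ℝ := fun f => q f (σN f) with hlo
    set hi : Fin k → ℝ := fun f => q f (σN (f + 1)) with hhi
    -- hypotheses of the chimera inequality
    have hq' : ∀ f, ENNReal.ofReal (θ f * 32) ≤
        volume (W (A f) ∩ {y : E3 | lo f < ⟪y, n⟫_ℝ ∧ ⟪y, n⟫_ℝ < hi f}) := by
      intro f
      have h := hq f (σN f) (σN (f + 1)) (hσN0 _) (hσNmono (Nat.le_succ _)) (hσN1 _ f.is_lt)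
      have e : σN (f + 1) - σN f = θ f := by rw [hσNsucc]; ring
      rwa [e] at h
    have hθV : ∀ f, ENNReal.ofReal (θ f * V') ≤ volume (G' f) := by
      intro f
      rw [hθ]; simp only []
      rw [div_mul_cancel₀ _ hV'pos.ne', ENNReal.ofReal_toReal (hG'fin f)]
    have hsub : ∀ f, ∀ x ∈ E ∩ {x : E3 | a f.castSucc < ⟪x, n⟫_ℝ ∧ ⟪x, n⟫_ℝ < β f},
        ∀ w ∈ W (A f), x + r • w ∈ C := by
      intro f x hx w hw
      exact mem_iUnion.2 ⟨f, mem_iUnion₂.2 ⟨x, hG'sub f hx,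
        Set.mem_vadd_set.2 ⟨r • w, Set.smul_mem_smul_set hw, rfl⟩⟩⟩
    have hloQ : ∀ f, |lo f| ≤ Q := fun f => hQ f _ (hσN0 _) (hσN1 _ (Nat.le_of_lt f.is_lt))
    have hhiQ : ∀ f, |hi f| ≤ Q := fun f => hQ f _ (hσN0 _) (hσN1 _ f.is_lt)
    -- windows are pairwise disjoint: sup of window f ≤ inf of window g for f < g
    have hsep : ∀ f g : Fin k, f < g → β f + r * hi f ≤ a g.castSucc + r * lo g := by
      intro f g hfg
      by_cases hnext : (f : ℕ) + 1 = g
      · -- consecutive: the mismatch bound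
        have hqq' := hqq f g (σN (f + 1)) hnext (hσN0 _) (hσN1 _ f.is_lt)
        have hcast : a f.succ = a g.castSucc := by
          congr 1; ext; simp [Fin.val_succ, hnext]
        have hlo' : lo g = q g (σN (f + 1)) := by rw [hlo]; simp only []; rw [← hnext]
        rw [hβ, hlo', ← hcast]; simp only []
        nlinarith [hr0]
      · -- far apart: a whole lamella lies in between
        have hfg2 : (f : ℕ) + 2 ≤ g := by
          have := Fin.lt_def.1 hfg; omega
        have hf1k : (f : ℕ) + 1 < k := by have := g.is_lt; omega
        set f1 : Fin k := ⟨(f : ℕ) + 1, hf1k⟩ with hf1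
        have hgap := hm₀le f1
        have hcs : a f1.castSucc = a f.succ := by congr 1
        have hss : a f1.succ ≤ a g.castSucc := hamono (by
          rw [Fin.le_iff_val_le_val]; simp [hf1]; omega)
        have hlog : -Q ≤ lo g := (abs_le.1 (hloQ g)).1
        have hhif : hi f ≤ Q := (abs_le.1 (hhiQ f)).2
        rw [hβ]; simp only []
        rw [hcs] at hgap
        nlinarith [hr0, hrm, hδ, hQ0]
    have hdisj : ∀ f g : Fin k, f ≠ g →
        Disjoint (Set.Ioo (a f.castSucc + r * lo f) (β f + r * hi f))
          (Set.Ioo (a g.castSucc + r * lo g) (β g + r * hi g)) := by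
      intro f g hfg
      rw [Set.disjoint_left]
      intro x hxf hxg
      rcases lt_or_gt_of_ne hfg with h | h
      · have := hsep f g h; linarith [hxf.2, hxg.1]
      · have := hsep g f h; linarith [hxg.2, hxf.1]
    -- lower bound (chimera with runs) and upper bound (Minkowski content)
    have hlow := inclined_chimera_lower_of_disjoint n hn (fun f => a f.castSucc) β E hEm
      (fun f => W (A f)) hWc hr0 hCm hsub θ hθ0 hθ1 hV'pos hθV lo hi hq' hdisj
    have hupC : (volume C).toReal ≤ V + r * (F + ε) := hup r hr0 hrr₀
    -- to real numbers
    set c : ℝ := (32 : ℝ) ^ ((3 : ℝ)⁻¹) with hc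
    have hc0 : 0 ≤ c := by positivity
    set x : ℝ := V' ^ ((3 : ℝ)⁻¹) with hx
    have hx0 : 0 ≤ x := by positivity
    have hx3 : x ^ 3 = V' := by
      rw [hx, show ((3 : ℝ)⁻¹) = ((3 : ℕ) : ℝ)⁻¹ by norm_num]
      exact Real.rpow_inv_natCast_pow hV'pos.le (by norm_num)
    have h2 : (x + r * c) ^ 3 ≤ V + r * (F + ε) := by
      have h := ENNReal.toReal_mono hCfin hlow
      rw [ENNReal.toReal_ofReal (by positivity)] at h
      exact h.trans hupC
    have hexp : x ^ 3 + r * (3 * c * x ^ 2) ≤ (x + r * c) ^ 3 := by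
      have hrc : 0 ≤ r * c := mul_nonneg hr0.le hc0
      have hid : (x + r * c) ^ 3 = x ^ 3 + r * (3 * c * x ^ 2) + (3 * x * (r * c) ^ 2 + (r * c) ^ 3) := by
        ring
      have htail : 0 ≤ 3 * x * (r * c) ^ 2 + (r * c) ^ 3 :=
        add_nonneg (mul_nonneg (mul_nonneg (by norm_num) hx0) (sq_nonneg _)) (pow_nonneg hrc 3)
      rw [hid]
      linarith only [htail]
    have h3 : r * (3 * c * x ^ 2) ≤ r * (F + ε + D) := by
      have h6 : x ^ 3 + r * (3 * c * x ^ 2) ≤ V' + r * D + r * (F + ε) := by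
        linarith only [hexp, h2, hVV']
      rw [hx3] at h6
      linarith only [h6]
    have h4 : 3 * c * x ^ 2 ≤ F + ε + D := le_of_mul_le_mul_left h3 hr0
    -- `V' ≥ V − ε`
    have hV'ge : V - ε ≤ V' := by linarith only [hVV', hrD]
    have hxge : (V - ε) ^ ((3 : ℝ)⁻¹) ≤ x :=
      Real.rpow_le_rpow (by linarith) hV'ge (by positivity)
    have h5 : 3 * c * ((V - ε) ^ ((3 : ℝ)⁻¹)) ^ 2 ≤ 3 * c * x ^ 2 := by
      have h0 : 0 ≤ (V - ε) ^ ((3 : ℝ)⁻¹) := Real.rpow_nonneg (by linarith only [hεV]) _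
      have h7 : ((V - ε) ^ ((3 : ℝ)⁻¹)) ^ 2 ≤ x ^ 2 := pow_le_pow_left₀ h0 hxge 2
      exact mul_le_mul_of_nonneg_left h7 (by positivity)
    linarith only [h4, h5]
  -- let `ε → 0`
  set c : ℝ := (32 : ℝ) ^ ((3 : ℝ)⁻¹) with hc
  have hcont : Continuous fun ε : ℝ => 3 * c * ((V - ε) ^ ((3 : ℝ)⁻¹)) ^ 2 - ε := by
    have h1 : Continuous fun ε : ℝ => (V - ε) ^ ((3 : ℝ)⁻¹) :=
      (continuous_const.sub continuous_id).rpow_const fun _ => Or.inr (by positivity)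
    exact (continuous_const.mul (h1.pow 2)).sub continuous_id
  have hlim : Tendsto (fun ε : ℝ => 3 * c * ((V - ε) ^ ((3 : ℝ)⁻¹)) ^ 2 - ε) (𝓝[>] 0)
      (𝓝 (3 * c * (V ^ ((3 : ℝ)⁻¹)) ^ 2)) := by
    have h := hcont.tendsto 0
    simp only [sub_zero] at h
    exact tendsto_nhdsWithin_of_tendsto_nhds h
  have hev : ∀ᶠ ε in 𝓝[>] (0 : ℝ), 3 * c * ((V - ε) ^ ((3 : ℝ)⁻¹)) ^ 2 - ε ≤ F + D := by
    filter_upwards [Ioo_mem_nhdsGT hVpos] with ε hε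
    have := key ε hε.1 hε.2
    linarith only [this]
  have hfin := le_of_tendsto hlim hev
  rw [wulff_constant_eq hV0]
  exact hfin

/-- **Rung `rung_inclinedLamellar_of_cdfShift_local`** (section bounds only for `h < h₀`): inclined lamellar textures whose consecutive bodies'
cumulative section volumes along `n` are `δ`-shifts of each other satisfy
`6·2^{1/3}(√2·Vol)^{2/3} ≤ Fr + δ·Σ S_f`. -/
theorem rung_inclinedLamellar_of_cdfShift_local : let Λ : Set (EuclideanSpace ℝ (Fin 3)) := Literature.MathematicalPhysics.StatisticalMechanics.fccStacking 1 (Real.sqrt (2 / 3)); let Φ : EuclideanSpace ℝ (Fin 3) → ℝ := fun ν => Real.sqrt 2 / 4 * ∑ᶠ w ∈ {w ∈ Λ | ‖w‖ = 1}, |⟪w, ν⟫_ℝ|; let Per : Set (EuclideanSpace ℝ (Fin 3)) → Set (EuclideanSpace ℝ (Fin 3)) → ℝ := fun K S => (⨆ (ξ : EuclideanSpace ℝ (Fin 3) → EuclideanSpace ℝ (Fin 3)) (_ : ContDiff ℝ 1 ξ ∧ HasCompactSupport ξ ∧ ∀ z, ξ z ∈ K), ENNReal.ofReal (∫ z in S,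 Literature.MathematicalPhysics.StatisticalMechanics.fieldDivergence ξ z)).toReal; let ι : Set (EuclideanSpace ℝ (Fin 3)) → Set (EuclideanSpace ℝ (Fin 3)) → Set (EuclideanSpace ℝ (Fin 3)) → ℝ := fun K S₁ S₂ => (Per K S₁ + Per K S₂ - Per K (S₁ ∪ S₂)) / 2; let W : (EuclideanSpace ℝ (Fin 3) ≃ₗᵢ[ℝ] EuclideanSpace ℝ (Fin 3)) → Set (EuclideanSpace ℝ (Fin 3)) := fun A => {y | ∀ ν : EuclideanSpace ℝ (Fin 3), ⟪y, ν⟫_ℝ ≤ Φ (A.symm ν)}; let Vol : (n : ℕ) → (Fin n → Set (EuclideanSpace ℝ (Fin 3))) → ℝ := fun n G => (volume (⋃ f : Fin n, G f)).toReal; let Poly : Set (EuclideanSpace ℝ (Fin 3)) → Prop := fun S => ∃ (k : ℕ) (H : Fin k → Finset ((EuclideanSpace ℝ (Fin 3)) × ℝ)), S = ⋃ i, ⋂ p ∈ H i, {x | ⟪p.1, x⟫_ℝ < p.2}; let Fr : (n : ℕ) → (Fin n → Set (EuclideanSpace ℝ (Fin 3))) → (Fin n → (EuclideanSpace ℝ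 (Fin 3) ≃ₗᵢ[ℝ] EuclideanSpace ℝ (Fin 3))) → ℝ := fun n G A => ∑ f : Fin n, Per (W (A f)) (G f) - ∑ f, ∑ g, (if f = g then 0 else ι (W (A f)) (G f) (G g)); ∀ (E : Set (EuclideanSpace ℝ (Fin 3))), Poly E → volume E < ⊤ → ∀ (n : EuclideanSpace ℝ (Fin 3)), ‖n‖ = 1 → ∀ (k : ℕ) (a : Fin (k + 1) → ℝ), StrictMono a → ∀ (A : Fin k → (EuclideanSpace ℝ (Fin 3) ≃ₗᵢ[ℝ] EuclideanSpace ℝ (Fin 3))) (δ : ℝ) (S : Fin k → ℝ), 0 ≤ δ → (∀ (f g : Fin k), (f : ℕ) + 1 = g → ∀ t : ℝ, volume (W (A g) ∩ {y | ⟪y, n⟫_ℝ < t}) ≤ volume (W (A f) ∩ {y | ⟪y, n⟫_ℝ < t + δ})) → (∀ f, 0 ≤ S f) → ∀ (h₀ : ℝ), 0 < h₀ → (∀ f (h : ℝ), 0 < h → h < h₀ → volume (E ∩ {x | a f.succ - h ≤ ⟪x, n⟫_ℝ ∧ ⟪x, n⟫_ℝ < a f.succ}) ≤ ENNReal.ofReal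 (h * S f)) → 6 * (2 : ℝ) ^ ((1 : ℝ) / 3) * (Real.sqrt 2 * Vol k (fun f => E ∩ {x | a f.castSucc < ⟪x, n⟫_ℝ ∧ ⟪x, n⟫_ℝ < a f.succ})) ^ ((2 : ℝ) / 3) ≤ Fr k (fun f => E ∩ {x | a f.castSucc < ⟪x, n⟫_ℝ ∧ ⟪x, n⟫_ℝ < a f.succ}) A + δ * ∑ f, S f := by
  intro Λ Φ Per ι W Vol Poly Fr E hE hEv n hn k a ha A δ S hδ hshift hS0 h₀ hh₀ hS
  -- lower quantile functions of the bodies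
  have hdata : ∀ f, ∃ q : ℝ → ℝ, (∀ σ, |q σ| ≤ Real.sqrt 5 + 1) ∧
      (∀ σ₁ σ₂, 0 ≤ σ₁ → σ₁ ≤ σ₂ → σ₂ ≤ 1 →
        ENNReal.ofReal ((σ₂ - σ₁) * 32) ≤ volume (W (A f) ∩ {y : E3 | q σ₁ < ⟪y, n⟫_ℝ ∧ ⟪y, n⟫_ℝ < q σ₂})) ∧
      (∀ σ, 0 ≤ σ → σ ≤ 1 → (volume (W (A f) ∩ {y : E3 | ⟪y, n⟫_ℝ < q σ})).toReal = σ * 32) ∧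
      (∀ σ t, 0 ≤ σ → σ ≤ 1 → -(Real.sqrt 5 + 1) ≤ t →
        ENNReal.ofReal (σ * 32) ≤ volume (W (A f) ∩ {y : E3 | ⟪y, n⟫_ℝ < t}) → q σ ≤ t) :=
    fun f => exists_lowerQuantile_of_isCompact n hn (W (A f)) (isCompact_cruxWulffBody (A f))
      (Real.sqrt_nonneg 5) (cruxWulffBody_subset_closedBall (A f)) (by norm_num) (volume_cruxWulffBody (A f))
  choose q hqb hqmass hqval hqmin using hdata
  have hfin : ∀ f t, volume (W (A f) ∩ {y : E3 | ⟪y, n⟫_ℝ < t}) ≠ ⊤ := fun f t =>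
    ne_top_of_le_ne_top (isCompact_cruxWulffBody (A f)).measure_lt_top.ne (measure_mono inter_subset_left)
  have hqq : ∀ (f g : Fin k) (σ : ℝ), (f : ℕ) + 1 = g → 0 ≤ σ → σ ≤ 1 → q f σ ≤ q g σ + δ := by
    intro f g σ hfg h0 h1
    exact lowerQuantile_le_add_of_cdf_le n (W (A f)) (W (A g)) hδ (q f) (q g) (hqval g) (hqb g)
      (hfin g) (hqmin f) (hshift f g hfg) σ h0 h1
  exact rung_inclinedLamellar_of_quantiles_local E hE hEv n hn k a ha A q (Real.sqrt 5 + 1) δ S hqmass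
    (fun f σ _ _ => hqb f σ) hδ hqq hS0 h₀ hh₀ hS

end Summit.Ventures.Crystal3D.Cruxes.PolycrystalWulffBound.PolyDensity

end
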